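import Summits.SmoothPoincare4.SmoothPoincare4.Theorems.SoloInformedPuncturedRoute
import Summits.SmoothPoincare4.SmoothPoincare4.Theorems.SoloInformedRasmussenOnPath
import Literature.Geometry.Symplectic.GromovMcDuffChartFormProofs
import HarnessLib
import HarnessLib.Audit.Tags

/-!
# The first conjunct of the path in exotic-`ℝ⁴` form: punctured homotopy 4-spheres are `ℝ⁴`

Solo informed SmoothPoincare4, session 22.  The landed path reads
`SPC4 ⇐ EMB° ∧ SS4 ∧ (Γ₄ = 0)` and, modulo the last two, `SPC4 ⟺ EMB°`
(`smoothPoincare4_iff_puncturedEmbedding`, `SoloInformedPuncturedRoute.lean`), where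
EMB° = `PuncturedPoincareSphereEmbedding`: every punctured homotopy 4-sphere `Σ ∖ {p}` is
diffeomorphic to an open subset of the round `S⁴`.  This file types the same conjunct in the
language of exotic `ℝ⁴`'s,

* `PuncturedHomotopySphereStandard` (E3) — **for every closed smooth 4-manifold `Σ ≃ₕ S⁴` and every
  point `p`, the open manifold `Σ ∖ {p}` is diffeomorphic to `ℝ⁴`** (equivalently: no punctured
  homotopy 4-sphere is an exotic `ℝ⁴`; by Freedman `Σ ∖ {p}` is always homeomorphic to `ℝ⁴`, a fact
  not used here),

and proves, with no input beyond the tree's PROVED Palais chart-form theorem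
`Literature.Geometry.Symplectic.palais_puncturedSphere_chartForm_holds` (`M ≅ S⁴ ⇒ M ∖ {p} ≅ ℝ⁴`;
Palais 1960 Thm. B, discharged in `GromovMcDuffChartFormProofs.lean`):

* `puncturedHomotopySphereStandard_of_smoothPoincare4 : SPC4 → E3`;
* `puncturedPoincareSphereEmbedding_of_puncturedHomotopySphereStandard : E3 → EMB°`
  (`Σ ∖ {p} ≅ ℝ⁴ ≅ S⁴ ∖ {N}`, an open subset of `S⁴`);
* `smoothPoincare4_of_puncturedStandard_of_schoenfliesBallConjecture : E3 → SS4 → (Γ₄ = 0) → SPC4`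
  and `smoothPoincare4_iff_puncturedStandard : SS4 → (Γ₄ = 0) → (SPC4 ↔ E3)`, so that modulo the
  Schoenflies conjecture (ball form) and Cerf's theorem the three statements SPC4, EMB°, E3 are
  equivalent with every implication kernel-checked (`puncturedStandard_iff_puncturedEmbedding`);
* the negative side at kernel level: a knot slice in a homotopy 4-ball but not in `B⁴`
  (`not_puncturedHomotopySphereStandard_of_isHomotopyBallSlice_not_isSmoothlySlice`), or a success of
  the FGMW `s`-invariant strategy given Rasmussen's theorem
  (`not_puncturedHomotopySphereStandard_of_fgmwRasmussenStrategy`), produces a **punctured homotopy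
  4-sphere that is not diffeomorphic to `ℝ⁴`**
  (`exists_puncturedHomotopySphere_not_diffeomorph_of_isHomotopyBallSlice_not_isSmoothlySlice`) —
  i.e. the object such a knot would exhibit is an exotic `ℝ⁴` with a one-point smooth
  compactification, and it refutes the conjunct E3 = EMB° of the path, saying nothing about SS4 or `Γ₄`.

In ordinary mathematics E3 ⟺ EMB° ⟺ EMB (the ball form, Hass–Kirby 2025 Question 4.2)
unconditionally: E3 ⟹ EMB° is proved here; EMB ⟹ E3 is the smooth Eilenberg–Mazur swindle (if the
Poincaré ball `Δ = Σ°` embeds in `S⁴` with complementary Poincaré ball `Δ'`, then `Δ ♮ Δ' ≅ B⁴` by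
Palais' disc theorem, the infinite boundary sum `Δ ♮ Δ' ♮ Δ ♮ ⋯` is both `int`-diffeomorphic to `ℝ⁴`
and to `int (Δ ♮ B⁴ ♮ B⁴ ♮ ⋯)`, whence `int Δ ≅ ℝ⁴` and `Σ ∖ {p} = Δ ∪ (S³ × [0,1)) ≅ int Δ ≅ ℝ⁴`;
Mazur 1959/1961).  That direction needs infinite boundary sums and is NOT formalised; in the kernel
the circle closes through SS4 and `Γ₄ = 0` instead.

Sources: J. Hass, R. Kirby, *Characterizing the 4-sphere, `S⁴`*, J. Open Math. Problems 1 (2025),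
§4 Question 4.2 and Lemma 4.1 [HassKirby2025]; M. Freedman, R. Gompf, S. Morrison, K. Walker,
Quantum Topol. 1 (2010) 171–208, §1–2 [FreedmanGompfMorrisonWalker2010]; R. Kirby, *The topology of
4-manifolds*, LNM 1374 (1989), Ch. XIV (exotic `ℝ⁴`'s; Remark 2 p. 87: a large exotic `ℝ⁴` embeds
in no homotopy 4-sphere) [Kirby1989]; R. Palais, *Extending diffeomorphisms*, Proc. AMS 11 (1960),
Thm. B [Palais1960]; B. Mazur, *On embeddings of spheres*, Bull. AMS 65 (1959) 59–65 [Mazur1959].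
No new axioms, no `sorry`; one new `Prop` definition (an open conjecture, tagged); nothing here
decides E3, EMB°, SS4 or SPC4.
-/

noncomputable section

open scoped Manifold ContDiff Topology
open Set Function ContinuousMap

namespace Summit.SmoothPoincare4.SmoothPoincare4.Theorems

open Literature.Topology.FourManifolds Literature.Geometry.Manifold

/-! ### The statement -/

/-- **Punctured homotopy 4-spheres are standard `ℝ⁴`'s** (E3).  For every Hausdorff
second-countable compact smooth 4-manifold `M` (model `ℝ⁴`, so `∂M = ∅`) homotopy equivalent to
`S⁴` and every point `p`, the open submanifold `M ∖ {p}` is diffeomorphic to `ℝ⁴`.  Open; implied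
by SPC4 (`puncturedHomotopySphereStandard_of_smoothPoincare4`), implies the punctured embedding
property EMB° (`puncturedPoincareSphereEmbedding_of_puncturedHomotopySphereStandard`), and modulo
the Schoenflies conjecture (ball form) and `Γ₄ = 0` equivalent to SPC4
(`smoothPoincare4_iff_puncturedStandard`).  Its negation says: some punctured homotopy 4-sphere is
an exotic `ℝ⁴` (homeomorphic to `ℝ⁴` by Freedman, not diffeomorphic to it).  OPEN CONJECTURE — not
dischargeable: use as a hypothesis.
[cite: HassKirby2025, §4 Question 4.2] [cite: FreedmanGompfMorrisonWalker2010, §1] -/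
@[conjecture] def PuncturedHomotopySphereStandard : Prop :=
  ∀ (M : Type) [TopologicalSpace M] [T2Space M] [SecondCountableTopology M]
    [ChartedSpace (EuclideanSpace ℝ (Fin 4)) M] [IsManifold (𝓡 4) ∞ M] [CompactSpace M],
    Nonempty (M ≃ₕ (Metric.sphere (0 : EuclideanSpace ℝ (Fin (4 + 1))) 1)) → ∀ p : M,
      Nonempty ((⟨({p}ᶜ : Set M), isOpen_compl_singleton⟩ : TopologicalSpace.Opens M)
        ≃ₘ⟮𝓡 4, 𝓡 4⟯ EuclideanSpace ℝ (Fin 4))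

/-! ### SPC4 → E3 → EMB° -/

/-- **SPC4 implies that punctured homotopy 4-spheres are `ℝ⁴`**: compose a diffeomorphism `M ≅ S⁴`
with Palais' punctured-sphere chart form `M ≅ S⁴ ⇒ M ∖ {p} ≅ ℝ⁴`
(`Literature.Geometry.Symplectic.palais_puncturedSphere_chartForm_holds`, proved in the tree; the
agreement with the inverted chart near `p` is discarded). [cite: Palais1960, Thm. B] -/
theorem puncturedHomotopySphereStandard_of_smoothPoincare4 (h : SmoothPoincare4) :
    PuncturedHomotopySphereStandard := by
  intro M _ _ _ _ _ _ hM p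
  obtain ⟨Ψ⟩ := h M inferInstance inferInstance hM.some
  obtain ⟨Φ, -⟩ :=
    Literature.Geometry.Symplectic.palais_puncturedSphere_chartForm_holds M p ⟨Ψ⟩
  exact ⟨Φ⟩

/-- **E3 implies the punctured embedding property EMB°**: if `M ∖ {p} ≅ ℝ⁴`, then since
`ℝ⁴ ≅ S⁴ ∖ {N}` for any point `N ∈ S⁴` (Palais' chart form on the round sphere itself,
`palais_puncturedSphere_chartForm.sphere`), `M ∖ {p}` is diffeomorphic to the open subset
`S⁴ ∖ {N}` of `S⁴`. [folklore] -/
theorem puncturedPoincareSphereEmbedding_of_puncturedHomotopySphereStandard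
    (hE : PuncturedHomotopySphereStandard) : PuncturedPoincareSphereEmbedding := by
  intro M _ _ _ _ _ _ hM p
  obtain ⟨Φ⟩ := hE M hM p
  obtain ⟨y, hy⟩ := (NormedSpace.sphere_nonempty (E := EuclideanSpace ℝ (Fin (4 + 1)))
    (x := (0 : EuclideanSpace ℝ (Fin (4 + 1)))) (r := (1 : ℝ))).2 zero_le_one
  obtain ⟨Ψ, -⟩ :=
    Literature.Geometry.Symplectic.palais_puncturedSphere_chartForm_holds.sphere ⟨y, hy⟩
  exact ⟨Literature.Geometry.Symplectic.punctured
      (⟨y, hy⟩ : Metric.sphere (0 : EuclideanSpace ℝ (Fin (4 + 1))) 1), ⟨Φ.trans Ψ.symm⟩⟩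

/-! ### E3 in the path -/

/-- **SPC4 from E3 and the Schoenflies conjecture (ball form), given `Γ₄ = 0`**: E3 gives EMB°
(`puncturedPoincareSphereEmbedding_of_puncturedHomotopySphereStandard`) and the landed
`smoothPoincare4_of_puncturedEmbedding_of_schoenfliesBall` concludes.  The Schoenflies hypothesis
`hS` is spelled out verbatim (it is `SchoenfliesBallConjectureFour`).
[cite: HassKirby2025, §4 Lemma 4.1 and Question 4.2] -/
theorem smoothPoincare4_of_puncturedStandard_of_schoenfliesBall
    (hE : PuncturedHomotopySphereStandard)
    (hS : ∀ (W : Type) [TopologicalSpace W] [T2Space W] [SecondCountableTopology W]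
      [ChartedSpace (EuclideanHalfSpace (3 + 1)) W] [IsManifold (𝓡∂ (3 + 1)) ∞ W] [CompactSpace W]
      (b : BoundaryData (𝓡∂ (3 + 1)) W (𝓡 3)),
      Nonempty (b.carrier ≃ₘ⟮𝓡 3, 𝓡 3⟯ (Metric.sphere (0 : EuclideanSpace ℝ (Fin (3 + 1))) 1)) →
      (∃ φ : W → (Metric.sphere (0 : EuclideanSpace ℝ (Fin (3 + 1 + 1))) 1),
        Manifold.IsSmoothEmbedding (𝓡∂ (3 + 1)) (𝓡 (3 + 1)) ∞ φ) →
      Nonempty (W ≃ₘ⟮𝓡∂ (3 + 1), 𝓡∂ (3 + 1)⟯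
        (Metric.closedBall (0 : EuclideanSpace ℝ (Fin (3 + 1))) 1)))
    (hC : cerf_twistedSphere_four) : SmoothPoincare4 :=
  smoothPoincare4_of_puncturedEmbedding_of_schoenfliesBall
    (puncturedPoincareSphereEmbedding_of_puncturedHomotopySphereStandard hE) hS hC

/-- Named-hypothesis form: **E3 → (Schoenflies conjecture, ball form) → (`Γ₄ = 0`) → SPC4**.
[cite: HassKirby2025, §4 Lemma 4.1 and Question 4.2] -/
theorem smoothPoincare4_of_puncturedStandard_of_schoenfliesBallConjecture
    (hE : PuncturedHomotopySphereStandard) (hS : SchoenfliesBallConjectureFour)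
    (hC : cerf_twistedSphere_four) : SmoothPoincare4 :=
  smoothPoincare4_of_puncturedStandard_of_schoenfliesBall hE hS hC

/-- **Modulo the Schoenflies conjecture (ball form) and `Γ₄ = 0`, SPC4 is equivalent to E3**
("no punctured homotopy 4-sphere is an exotic `ℝ⁴`"), both directions kernel-checked.
[cite: HassKirby2025, §4] -/
theorem smoothPoincare4_iff_puncturedStandard (hS : SchoenfliesBallConjectureFour)
    (hC : cerf_twistedSphere_four) : SmoothPoincare4 ↔ PuncturedHomotopySphereStandard :=
  ⟨puncturedHomotopySphereStandard_of_smoothPoincare4,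
    fun hE ↦ smoothPoincare4_of_puncturedStandard_of_schoenfliesBallConjecture hE hS hC⟩

/-- **Modulo the Schoenflies conjecture (ball form) and `Γ₄ = 0`, E3 and EMB° are equivalent**
(`→` is unconditional, `puncturedPoincareSphereEmbedding_of_puncturedHomotopySphereStandard`; `←`
goes through SPC4).  Unconditionally the converse is the smooth Eilenberg–Mazur swindle, not
formalised (module docstring). [folklore] -/
theorem puncturedStandard_iff_puncturedEmbedding (hS : SchoenfliesBallConjectureFour)
    (hC : cerf_twistedSphere_four) :
    PuncturedHomotopySphereStandard ↔ PuncturedPoincareSphereEmbedding :=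
  ⟨puncturedPoincareSphereEmbedding_of_puncturedHomotopySphereStandard,
    fun hE ↦ puncturedHomotopySphereStandard_of_smoothPoincare4
      (smoothPoincare4_of_puncturedEmbedding_of_schoenfliesBallConjecture hE hS hC)⟩

/-! ### The negative side: exotic `ℝ⁴`'s with a one-point compactification -/

/-- **A knot slice in a homotopy 4-ball but not in `B⁴` refutes E3** (through EMB°:
`not_puncturedPoincareSphereEmbedding_of_isHomotopyBallSlice_not_isSmoothlySlice`).
[cite: FreedmanGompfMorrisonWalker2010, §2 Fact 2.1] [cite: ManolescuPiccirillo2023, §1] -/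
theorem not_puncturedHomotopySphereStandard_of_isHomotopyBallSlice_not_isSmoothlySlice
    (h : ∃ K : Knot, K.IsHomotopyBallSlice ∧ ¬ K.IsSmoothlySlice) :
    ¬ PuncturedHomotopySphereStandard := fun hE ↦
  not_puncturedPoincareSphereEmbedding_of_isHomotopyBallSlice_not_isSmoothlySlice h
    (puncturedPoincareSphereEmbedding_of_puncturedHomotopySphereStandard hE)

/-- **A success of the FGMW `s`-invariant strategy refutes E3**, GIVEN Rasmussen's slice-genus
theorem (`eq_zero_of_isSmoothlySlice`): through EMB°,
`not_puncturedPoincareSphereEmbedding_of_fgmwRasmussenStrategy`.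
[cite: FreedmanGompfMorrisonWalker2010, §1] -/
theorem not_puncturedHomotopySphereStandard_of_fgmwRasmussenStrategy
    (hs0 : eq_zero_of_isSmoothlySlice)
    (h : Literature.Barriers.SmoothPoincare4.FGMWRasmussenStrategy) :
    ¬ PuncturedHomotopySphereStandard := fun hE ↦
  not_puncturedPoincareSphereEmbedding_of_fgmwRasmussenStrategy hs0 h
    (puncturedPoincareSphereEmbedding_of_puncturedHomotopySphereStandard hE)

/-- **The exotic `ℝ⁴` a homotopy-ball-slice, non-slice knot would exhibit.**  If some knot is slice
in a homotopy 4-ball but not in `B⁴`, then there are a closed smooth 4-manifold `M ≃ₕ S⁴` and a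
point `p ∈ M` such that `M ∖ {p}` is NOT diffeomorphic to `ℝ⁴` — an open 4-manifold with a smooth
one-point compactification to a homotopy sphere which is not the standard `ℝ⁴` (by Freedman's
theorem, not used, it is homeomorphic to `ℝ⁴`: an exotic `ℝ⁴`).  Unfolding of
`not_puncturedHomotopySphereStandard_of_isHomotopyBallSlice_not_isSmoothlySlice`.
[cite: FreedmanGompfMorrisonWalker2010, §2 Fact 2.1] [cite: Kirby1989, Ch. XIV] -/
theorem exists_puncturedHomotopySphere_not_diffeomorph_of_isHomotopyBallSlice_not_isSmoothlySlice
    (h : ∃ K : Knot, K.IsHomotopyBallSlice ∧ ¬ K.IsSmoothlySlice) :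
    ∃ (M : Type) (_ : TopologicalSpace M) (_ : T2Space M) (_ : SecondCountableTopology M)
      (_ : ChartedSpace (EuclideanSpace ℝ (Fin 4)) M) (_ : IsManifold (𝓡 4) ∞ M)
      (_ : CompactSpace M),
      Nonempty (M ≃ₕ (Metric.sphere (0 : EuclideanSpace ℝ (Fin (4 + 1))) 1)) ∧ ∃ p : M,
        IsEmpty ((⟨({p}ᶜ : Set M), isOpen_compl_singleton⟩ : TopologicalSpace.Opens M)
          ≃ₘ⟮𝓡 4, 𝓡 4⟯ EuclideanSpace ℝ (Fin 4)) := by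
  by_contra hcon
  refine not_puncturedHomotopySphereStandard_of_isHomotopyBallSlice_not_isSmoothlySlice h ?_
  intro M _ _ _ _ _ _ hM p
  by_contra hp
  exact hcon ⟨M, inferInstance, inferInstance, inferInstance, inferInstance, inferInstance,
    inferInstance, hM, p, not_nonempty_iff.mp hp⟩

/-- **Under the two other hypotheses of the path, SPC4 fails iff some punctured homotopy 4-sphere
is not `ℝ⁴`**: the contrapositive reading of `smoothPoincare4_iff_puncturedStandard` — modulo
Schoenflies (ball form) and `Γ₄ = 0`, an exotic homotopy 4-sphere exists iff an exotic `ℝ⁴` with a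
smooth one-point compactification to a homotopy sphere exists. [cite: HassKirby2025, §4] -/
theorem not_smoothPoincare4_iff_not_puncturedStandard (hS : SchoenfliesBallConjectureFour)
    (hC : cerf_twistedSphere_four) : ¬ SmoothPoincare4 ↔ ¬ PuncturedHomotopySphereStandard :=
  not_congr (smoothPoincare4_iff_puncturedStandard hS hC)

end Summit.SmoothPoincare4.SmoothPoincare4.Theorems

end
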